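import Mathlib
import Summits.Ventures.PercRepro2.IteratedBK

/-!
# Iterated BK for closed cuts: the a = 1 rows of the BAL family for the distance `D`
(the path-dual row B2*) on every finite multigraph (seat mine-b, cell pub-perc-repro2)

`IteratedBK.lean` treats `k` pairwise disjoint OPEN witnesses of an increasing event.  The distance
`D` to the connection event (row B2*, MINE-B.md §8.2) satisfies `D ≥ k` iff the CLOSED edges contain
`k` pairwise disjoint `s–t` cuts (length–width duality, proofs/MINE-B-DUAL.md §1); here that is taken
as the definition `cutEvent ends s t k` (the `k`-fold disjoint occurrence, in the closed configuration,
of the event "the closed edges separate `s` from `t`").  Complementing every edge state turns the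
product measure with vector `p` into the one with vector `1 − p`, so the iterated BK inequality of
`IteratedBK.lean` transfers: `P(D ≥ k+1) ≤ P(D ≥ 1)·P(D ≥ k)` and `P(D ≥ k) ≤ P(s ↮ t)^k` for every
finite multigraph and every `p ∈ [0,1]^E` (`cutEvent_succ_le`, `cutEvent_le_pow`).
-/

open Finset

namespace Summit.Ventures.PercRepro2

section Complement

variable {E : Type*} [Fintype E] [DecidableEq E]

/-- the closed edges of a configuration -/
def closedSet (ω : Config E) : Finset E := Finset.univ.filter (fun e => ω e = false)

/-- the complementary configuration -/
def compl (ω : Config E) : Config E := fun e => !(ω e)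

omit [Fintype E] [DecidableEq E] in
/-- complementing twice is the identity -/
@[simp] lemma compl_compl (ω : Config E) : compl (compl ω) = ω := by
  funext e; simp [compl]

omit [Fintype E] [DecidableEq E] in
/-- `compl` is an involution -/
lemma compl_involutive : Function.Involutive (compl : Config E → Config E) := compl_compl

omit [DecidableEq E] in
/-- the closed edges are the open edges of the complement -/
lemma closedSet_eq_openSet_compl (ω : Config E) : closedSet ω = openSet (compl ω) := by
  ext e; simp [closedSet, openSet, compl]

omit [DecidableEq E] in
/-- the weight of the complementary configuration is the weight for the vector `1 − p` -/
lemma weight_compl (p : E → ℝ) (ω : Config E) :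
    weight p (compl ω) = weight (fun e => 1 - p e) ω := by
  unfold weight
  apply Finset.prod_congr rfl
  intro e _
  cases h : ω e <;> simp [edgeFactor, compl, h]

/-- `compl` is a bijection, so probabilities transfer: `P_p(ω : compl ω ∈ X) = P_{1−p}(X)` -/
lemma prob_preimage_compl (p : E → ℝ) (X : Set (Config E)) :
    prob p {ω | compl ω ∈ X} = prob (fun e => 1 - p e) X := by
  unfold prob
  rw [← Equiv.sum_comp (Function.Involutive.toPerm compl compl_involutive)]
  apply Finset.sum_congr rfl
  intro ω _
  simp only [Function.Involutive.coe_toPerm]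
  by_cases h : ω ∈ X
  · have h' : compl ω ∈ {ω | compl ω ∈ X} := by simp [h]
    rw [Set.indicator_of_mem h', Set.indicator_of_mem h, weight_compl]
  · have h' : compl ω ∉ {ω | compl ω ∈ X} := by simp [h]
    rw [Set.indicator_of_notMem h', Set.indicator_of_notMem h]

omit [Fintype E] [DecidableEq E] in
/-- the vector `1 − p` is admissible when `p` is -/
lemma isProbVec_one_sub {p : E → ℝ} (hp : IsProbVec p) : IsProbVec (fun e => 1 - p e) :=
  ⟨fun e => by linarith [hp.le_one e], fun e => by linarith [hp.nonneg e]⟩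

end Complement

section Cuts

variable {V : Type*} {E : Type*} [Fintype E] [DecidableEq E]

/-- the edge set `S` separates `s` from `t`: the other edges do not carry `s` to `t`
(an increasing predicate on `S`) -/
def SeparatesCut (ends : E → Sym2 V) (S : Finset E) (s t : V) : Prop :=
  ¬ Carries ends (Finset.univ \ S) s t

/-- `SeparatesCut` is increasing -/
lemma incr_separatesCut (ends : E → Sym2 V) (s t : V) :
    ReimerCube.Incr (fun S : Finset E => SeparatesCut ends S s t) := by
  intro S T hST hS hT
  apply hS
  exact Carries.mono (Finset.sdiff_subset_sdiff le_rfl hST) hT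

/-- **The event `D ≥ k`**: the closed edges contain `k` pairwise disjoint `s–t` cuts. -/
def cutEvent (ends : E → Sym2 V) (s t : V) (k : ℕ) : Set (Config E) :=
  {ω | kDisj (fun S => SeparatesCut ends S s t) k (closedSet ω)}

/-- `D ≥ 1` is the disconnection event -/
theorem cutEvent_one (ends : E → Sym2 V) (s t : V) :
    cutEvent ends s t 1 = (connEvent ends s t)ᶜ := by
  ext ω
  simp only [cutEvent, Set.mem_setOf_eq, Set.mem_compl_iff, connEvent]
  rw [kDisj_one_iff (incr_separatesCut ends s t)]
  unfold SeparatesCut Carries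
  have h : Finset.univ \ closedSet ω = openSet ω := by
    ext e; simp [closedSet, openSet]
  rw [h, ofFinset_openSet]

/-- the cut event in the closed edges is the flow-type event of the complementary configuration
for the separation predicate -/
lemma cutEvent_eq_preimage (ends : E → Sym2 V) (s t : V) (k : ℕ) :
    cutEvent ends s t k
      = {ω | compl ω ∈ {ω' | kDisj (fun S => SeparatesCut ends S s t) k (openSet ω')}} := by
  ext ω
  simp only [cutEvent, Set.mem_setOf_eq, closedSet_eq_openSet_compl]

open Classical in
/-- the probability of `{ω | kDisj A k (openSet ω)}` as a weighted sum -/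
lemma prob_kDisj_openSet (p : E → ℝ) (A : Finset E → Prop) (k : ℕ) :
    prob p {ω | kDisj A k (openSet ω)}
      = ∑ S ∈ Finset.univ.powerset.filter (kDisj A k), ReimerCube.wt Finset.univ p S := by
  rw [prob_eq_sum_wt]
  apply sum_filter_congr_pred
  intro S
  simp only [Set.mem_setOf_eq, openSet_ofFinset]

/-- **The `a = 1` rows of the BAL family for the distance `D` on every finite multigraph**:
`P(D ≥ k+1) ≤ P(D ≥ 1) · P(D ≥ k)`. -/
theorem cutEvent_succ_le (p : E → ℝ) (hp : IsProbVec p) (ends : E → Sym2 V) (s t : V) (k : ℕ) :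
    prob p (cutEvent ends s t (k + 1)) ≤ prob p (cutEvent ends s t 1) * prob p (cutEvent ends s t k) := by
  classical
  have hq := isProbVec_one_sub hp
  have hq' : ∀ i, 0 ≤ (1 - p i) ∧ (1 - p i) ≤ 1 := fun i => ⟨hq.nonneg i, hq.le_one i⟩
  simp only [cutEvent_eq_preimage, prob_preimage_compl, prob_kDisj_openSet]
  have h1 : (∑ S ∈ Finset.univ.powerset.filter (kDisj (fun S => SeparatesCut ends S s t) 1),
      ReimerCube.wt Finset.univ (fun e => 1 - p e) S)
      = ∑ S ∈ Finset.univ.powerset.filter (fun S => SeparatesCut ends S s t),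
          ReimerCube.wt Finset.univ (fun e => 1 - p e) S := by
    apply sum_filter_congr_pred
    intro S
    exact kDisj_one_iff (incr_separatesCut ends s t) S
  rw [h1]
  exact kDisj_succ_le (fun e => 1 - p e) hq' _ (incr_separatesCut ends s t) k

/-- **`P(D ≥ k) ≤ P(s ↮ t)^k`** for every finite multigraph and product measure. -/
theorem cutEvent_le_pow (p : E → ℝ) (hp : IsProbVec p) (ends : E → Sym2 V) (s t : V) (k : ℕ) :
    prob p (cutEvent ends s t k) ≤ prob p (connEvent ends s t)ᶜ ^ k := by
  classical
  have hq := isProbVec_one_sub hp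
  have hq' : ∀ i, 0 ≤ (1 - p i) ∧ (1 - p i) ≤ 1 := fun i => ⟨hq.nonneg i, hq.le_one i⟩
  rw [← cutEvent_one]
  simp only [cutEvent_eq_preimage, prob_preimage_compl, prob_kDisj_openSet]
  have h1 : (∑ S ∈ Finset.univ.powerset.filter (kDisj (fun S => SeparatesCut ends S s t) 1),
      ReimerCube.wt Finset.univ (fun e => 1 - p e) S)
      = ∑ S ∈ Finset.univ.powerset.filter (fun S => SeparatesCut ends S s t),
          ReimerCube.wt Finset.univ (fun e => 1 - p e) S := by
    apply sum_filter_congr_pred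
    intro S
    exact kDisj_one_iff (incr_separatesCut ends s t) S
  rw [h1]
  exact kDisj_le_pow (fun e => 1 - p e) hq' _ (incr_separatesCut ends s t) k

end Cuts

end Summit.Ventures.PercRepro2
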